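import Literature.AlgebraicGeometry.Frobenioids.Cor54SubSquareCanonical
import HarnessLib

/-!
# Frobenioids I, Corollary 5.4 at THE constructions: non-vacuity of the Cor. 4.11 package (the identity)

Mochizuki, *The geometry of Frobenioids I: the general theory*, Kyushu J. Math. **62** (2008) 293–400,
Cor. 5.4 p. 104 [cite: MochizukiFrdI2008, Cor. 5.4 p.104].

PROOF-ONLY kernel bookkeeping (seat abc-iut-L1-t10 gen 3).  The joint closer
`FrdI.Cor54Sub.exists_rlfTransport_square'` (`Cor54SubSquareCanonical.lean`) takes the Cor. 4.11 package of
an equivalence `Ψ` as binders (`Ψ^istr`, `hΨistr`, `Ψ^un-tr`, `s`, `Ψ^Base`, `Ψ^Φ = E`, `η`, `hdeg`, `hdiv`,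
`BiratCompat`).  This file records that the package is JOINTLY INHABITED for every Frobenioid over a
perf-factorial divisor monoid — by the identity: `Ψ = 𝟭`, `Ψ^istr = 𝟭`, `Ψ^un-tr = 𝟭`, `Ψ^Base = 𝟭`,
`Ψ^Φ = 1`, `η = 1` — so that the conclusion of Cor. 5.4 (a realified equivalence `Ψ^rlf`, induced by the
data, 1-unique, making the square with THE natural functors `C^istr → C^rlf` 1-commute) is witnessed in
the kernel at genuine data, with no hypothesis beyond `IsFrobenioid F` and `Φ` perf-factorial.  Nothing
here bears on [IUTchIII]; a non-vacuity witness, not a new statement of the paper.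
-/

noncomputable section

namespace Literature.AlgebraicGeometry.Frobenioids

open CategoryTheory Opposite Literature.AnabelianGeometry.EtaleTheta

universe w v v' u u'

namespace FrdI.Cor54Sub

variable {D : Type u'} [Category.{v'} D] {Φ : Dᵒᵖ ⥤ CommMonCat.{w}}
  {C : Type u} [Category.{v} C] (F : C ⥤ ElemFrobenioid Φ) (hΦ : PreFrobenioid.IsPerfFactorialOn Φ)

/-- **Non-vacuity of Cor. 5.4 at THE constructions**: for every Frobenioid `C → F_Φ` over a perf-factorial
`Φ`, the Cor. 4.11 package of the IDENTITY (`Ψ^Base = 𝟭`, `Ψ^Φ = 1`, `η = 1`, `Ψ^istr = Ψ^un-tr = 𝟭`)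
satisfies every binder of `exists_rlfTransport_square'`; hence there is a realified equivalence
`Ψ^rlf : C^rlf ⥲ C^rlf` induced by `(𝟭, (1)^rlf)`, 1-unique among such, with `ι ⋙ Ψ^rlf ≅ 𝟭 ⋙ ι` for THE
natural functor `ι : C^istr → C^rlf` of Prop. 5.3. [cite: MochizukiFrdI2008, Cor. 5.4 p.104] -/
theorem exists_rlfTransport_square_identity (hF : PreFrobenioid.IsFrobenioid F) :
    ∃ (E : PreFrobenioidData.DivisorMonoidIsoOverBase
        (PreFrobenioidData.ofFunctor Φ F) (PreFrobenioidData.ofFunctor Φ F) (𝟭 D))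
      (Ψrlf : PreFrobenioid.rlf F hΦ ⥤ PreFrobenioid.rlf F hΦ),
      (∀ (X : D) (x : Φ.obj (op X)), E.iso X x = x) ∧ Ψrlf.IsEquivalence ∧
        IsInducedBy F hΦ F hΦ (𝟭 D) (rlfIso F hΦ F hΦ E) Ψrlf ∧
          Square hΦ hΦ (𝟭 _) (PreFrobenioid.untrComparison F hF) (PreFrobenioid.untrComparison F hF) Ψrlf ∧
            ∀ Ψrlf' : PreFrobenioid.rlf F hΦ ⥤ PreFrobenioid.rlf F hΦ,
              IsInducedBy F hΦ F hΦ (𝟭 D) (rlfIso F hΦ F hΦ E) Ψrlf' → Nonempty (Ψrlf ≅ Ψrlf') := by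
  -- the degenerate Cor. 4.11 data: `Ψ^Base = 𝟭`, `Ψ^Φ = 1`, `η = 1`
  let E : PreFrobenioidData.DivisorMonoidIsoOverBase
      (PreFrobenioidData.ofFunctor Φ F) (PreFrobenioidData.ofFunctor Φ F) (𝟭 D) :=
    { iso := fun X => MulEquiv.refl _
      natural := fun _ _ f x => rfl }
  let η : 𝟭 C ⋙ (PreFrobenioidData.ofFunctor Φ F).base ≅ (PreFrobenioidData.ofFunctor Φ F).base ⋙ 𝟭 D :=
    Iso.refl _
  have hdeg : ∀ ⦃A B : C⦄ (φ : A ⟶ B),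
      (PreFrobenioidData.ofFunctor Φ F).degFr ((𝟭 C).map φ) = (PreFrobenioidData.ofFunctor Φ F).degFr φ :=
    fun _ _ _ => rfl
  have hdiv : ∀ ⦃A B : C⦄ (φ : A ⟶ B),
      (PreFrobenioidData.ofFunctor Φ F).div ((𝟭 C).map φ) =
        (PreFrobenioidData.ofFunctor Φ F).pull (η.hom.app A)
          (E.iso ((PreFrobenioidData.ofFunctor Φ F).base.obj A) ((PreFrobenioidData.ofFunctor Φ F).div φ)) :=
    fun A B φ => ((PreFrobenioidData.ofFunctor Φ F).pull_id _ _).symm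
  have hbirat : BiratCompat F F (𝟭 D) E := by
    intro X
    show ((PreFrobenioid.biratSubfunctor F).carrier X).map
        (MonGp.map (M := Φ.obj (op X)) (N := Φ.obj (op X)) (MonoidHom.id _)) =
      (PreFrobenioid.biratSubfunctor F).carrier X
    rw [MonGp.map_id]
    exact Subgroup.map_id _
  obtain ⟨Ψrlf, h₁, h₂, h₃, h₄⟩ :=
    exists_rlfTransport_square' F hΦ F hΦ hF hF (𝟭 C) (𝟭 _) (Iso.refl _) (𝟭 _) (Iso.refl _) (𝟭 D) E η
      hdeg hdiv hbirat
  exact ⟨E, Ψrlf, fun _ _ => rfl, h₁, h₂, h₃, h₄⟩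

/-- `(1)^rlf = 1`: the realification (`rlfIso`) of the identity isomorphism of divisor monoids is the identity
(`f ↦ f^rlf` is functorial, `IsPerfFactorial.Rlf.map_id'`). [cite: MochizukiFrdI2008, Cor. 5.4 p.104] -/
theorem rlfIso_apply_of_eq_id
    (E : PreFrobenioidData.DivisorMonoidIsoOverBase
      (PreFrobenioidData.ofFunctor Φ F) (PreFrobenioidData.ofFunctor Φ F) (𝟭 D))
    (hE : ∀ (X : D) (x : Φ.obj (op X)), E.iso X x = x) (X : D)
    (y : (PreFrobenioid.IsPerfFactorialOn.op hΦ (op X)).Rlf) : (rlfIso F hΦ F hΦ E).iso X y = y := by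
  have hEX : (E.iso X).toMonoidHom = MonoidHom.id (Φ.obj (op X)) := MonoidHom.ext (hE X)
  show IsPerfFactorial.Rlf.map (PreFrobenioid.IsPerfFactorialOn.op hΦ (op X))
      (PreFrobenioid.IsPerfFactorialOn.op hΦ (op X)) (E.iso X).toMonoidHom y = y
  rw [hEX, IsPerfFactorial.Rlf.map_id']
  rfl

/-- The identity functor of `C^rlf` is induced by the identity data `(𝟭, (1)^rlf)`.
[cite: MochizukiFrdI2008, Cor. 5.4 p.104] -/
theorem isInducedBy_id
    (E : PreFrobenioidData.DivisorMonoidIsoOverBase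
      (PreFrobenioidData.ofFunctor Φ F) (PreFrobenioidData.ofFunctor Φ F) (𝟭 D))
    (hE : ∀ (X : D) (x : Φ.obj (op X)), E.iso X x = x) :
    IsInducedBy F hΦ F hΦ (𝟭 D) (rlfIso F hΦ F hΦ E) (𝟭 (PreFrobenioid.rlf F hΦ)) := by
  refine ⟨Iso.refl _, fun _ _ _ => rfl, fun A B φ => ?_⟩
  show (rlfData F hΦ).div φ = (rlfData F hΦ).pull (𝟙 _) _
  rw [(rlfData F hΦ).pull_id, rlfIso_apply_of_eq_id F hΦ E hE]

/-- **1-uniqueness at the identity**: every functor `C^rlf → C^rlf` induced by the identity data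
`(Ψ^Base, (Ψ^Φ)^rlf) = (𝟭, (1)^rlf)` is isomorphic to the identity functor — "the formation of `Ψ^rlf`" sends
the identity to the identity, up to isomorphism (row C54/L07, `oneUniqueData_holds`).
[cite: MochizukiFrdI2008, Cor. 5.4 p.104] -/
theorem nonempty_iso_id_of_isInducedBy_identity
    (E : PreFrobenioidData.DivisorMonoidIsoOverBase
      (PreFrobenioidData.ofFunctor Φ F) (PreFrobenioidData.ofFunctor Φ F) (𝟭 D))
    (hE : ∀ (X : D) (x : Φ.obj (op X)), E.iso X x = x)
    (Ψrlf : PreFrobenioid.rlf F hΦ ⥤ PreFrobenioid.rlf F hΦ)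
    (hΨrlf : IsInducedBy F hΦ F hΦ (𝟭 D) (rlfIso F hΦ F hΦ E) Ψrlf) :
    Nonempty (Ψrlf ≅ 𝟭 (PreFrobenioid.rlf F hΦ)) :=
  oneUniqueData_holds F hΦ F hΦ (𝟭 D) (rlfIso F hΦ F hΦ E) Ψrlf (𝟭 _) hΨrlf (isInducedBy_id F hΦ E hE)

end FrdI.Cor54Sub

end Literature.AlgebraicGeometry.Frobenioids

end
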